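import Mathlib.Algebra.BigOperators.Ring.Finset
import Mathlib.Algebra.Order.BigOperators.Group.Finset
import Mathlib.Data.Fintype.BigOperators
import Mathlib.Data.Real.Basic
import Mathlib.Tactic.Linarith
import Mathlib.Tactic.Positivity
import Mathlib.Tactic.FieldSimp
import Mathlib.Tactic.Ring
import HarnessLib

/-!
# Averaging, Markov and product counting over finite uniform spaces (toolkit)

Trunk T-CPLX-CORE. Elementary counting forms of the averaging arguments that recur in
reconstruction / hardness-amplification proofs (Arora–Barak 2009, proof of Thm. 9.12: "by a
simple averaging argument, for at least an `ε/2` fraction of the `x`'s …"; Impagliazzo–Jaiswal–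
Kabanets–Wigderson 2010, Remark 3.3: fixing the internal randomness of a randomized circuit by
averaging), stated over products of finite types with exact counts in `ℝ`. Written for the
decomposition of `Literature.Computability.Learning.cikk_natural_implies_learning`; everything proved.

* `card_goodRows_ge` — `≥ 1/2 + γ` of the pairs good ⇒ `≥ γ` of the rows have `≥ 1/2 + γ/2`
  of their entries good;
* `card_rows_ge_of_density` — `≥ ρ` of the pairs ⇒ `≥ ρ/2` of the rows have `≥ ρ/2`;
* `card_heavyRows_le` — Markov: `≤ η` of the pairs bad ⇒ `≤ η/θ` of the rows have `> θ` of
  their entries bad.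

(The product count `#{ω : Fin M → Γ | ∀ j, ω j ∈ S} = |S|^M` for independent repetitions is
already `Literature.Computability.QuantumComplexity.card_filter_forall_mem` in `QuantumComplexity/PostBPPAmplification.lean`.)

## References

* S. Arora, B. Barak, *Computational Complexity: A Modern Approach*, CUP 2009, proof of
  Thm. 9.12 [AroraBarak2009].
* R. Impagliazzo, R. Jaiswal, V. Kabanets, A. Wigderson, *Uniform direct product theorems*,
  SIAM J. Comput. 39 (2010), Remark 3.3 [ImpagliazzoEtAl2010].
-/

namespace Literature.Computability.Complexity

open Finset

/-- **Averaging** ("by a simple averaging argument, for at least an `ε/2` fraction of the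
`x`'s, the probability over `r` … is at least `1/2 + ε/2`", Arora–Barak, proof of Thm. 9.12;
CIKK, proof of Claim 4.4): if `P` holds for a `≥ 1/2 + γ` fraction of the pairs `(a, b)`, then
for a `≥ γ` fraction of the `a`'s it holds for a `≥ 1/2 + γ/2` fraction of the `b`'s.
[cite: AroraBarak2009, Thm. 9.12 (proof)] -/
theorem card_goodRows_ge {A B : Type*} [Fintype A] [Fintype B] [Nonempty B] (P : A → B → Prop)
    [∀ a b, Decidable (P a b)] {γ : ℝ} (hγ : 0 ≤ γ)
    (h : (1 / 2 + γ) * (Fintype.card A * Fintype.card B) ≤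
      ((univ.filter fun p : A × B => P p.1 p.2).card : ℝ)) :
    γ * Fintype.card A ≤ ((univ.filter fun a : A =>
      (1 / 2 + γ / 2) * Fintype.card B ≤ ((univ.filter fun b => P a b).card : ℝ)).card : ℝ) := by
  classical
  set good := univ.filter fun a : A =>
    (1 / 2 + γ / 2) * Fintype.card B ≤ ((univ.filter fun b => P a b).card : ℝ)
  have hrow : ∀ a : A, ((univ.filter fun b => P a b).card : ℝ) ≤ Fintype.card B := fun a => by
    exact_mod_cast (card_filter_le _ _).trans_eq (card_univ)
  -- the total splits into rows
  have htot : ((univ.filter fun p : A × B => P p.1 p.2).card : ℝ) =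
      ∑ a : A, ((univ.filter fun b => P a b).card : ℝ) := by
    rw [natCast_card_filter, Fintype.sum_prod_type]
    exact Finset.sum_congr rfl fun a _ => by rw [natCast_card_filter]
  -- split the rows into good and bad
  have hsplit : (∑ a : A, ((univ.filter fun b => P a b).card : ℝ)) ≤
      good.card * Fintype.card B + (Fintype.card A - good.card) *
        ((1 / 2 + γ / 2) * Fintype.card B) := by
    rw [← Finset.sum_filter_add_sum_filter_not univ (fun a : A =>
      (1 / 2 + γ / 2) * Fintype.card B ≤ ((univ.filter fun b => P a b).card : ℝ))]
    refine add_le_add ?_ ?_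
    · rw [← nsmul_eq_mul, ← Finset.sum_const]
      exact Finset.sum_le_sum fun a _ => hrow a
    · have hc : ((univ.filter fun a : A => ¬ ((1 / 2 + γ / 2) * Fintype.card B ≤
          ((univ.filter fun b => P a b).card : ℝ))).card : ℝ) = Fintype.card A - good.card := by
        have := Finset.card_filter_add_card_filter_not (s := (univ : Finset A)) (fun a : A =>
          (1 / 2 + γ / 2) * Fintype.card B ≤ ((univ.filter fun b => P a b).card : ℝ))
        rw [card_univ] at this
        rw [eq_sub_iff_add_eq, add_comm]; exact_mod_cast this
      rw [← hc, ← nsmul_eq_mul, ← Finset.sum_const]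
      exact Finset.sum_le_sum fun a ha => (not_le.1 (mem_filter.1 ha).2).le
  rw [htot] at h
  have hA : (0 : ℝ) ≤ Fintype.card A := Nat.cast_nonneg _
  have hB : (0 : ℝ) ≤ Fintype.card B := Nat.cast_nonneg _
  have hg0 : (0 : ℝ) ≤ good.card := Nat.cast_nonneg _
  have hgA : (good.card : ℝ) ≤ Fintype.card A := by
    exact_mod_cast (card_filter_le _ _).trans_eq (card_univ)
  -- `#good (1/2 - γ/2) |B| ≥ |A| |B| γ/2`, and `#good ≥ #good (1 - γ)`:
  have hBpos' : (0 : ℝ) < Fintype.card B := Nat.cast_pos.2 Fintype.card_pos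
  nlinarith [mul_nonneg hg0 (mul_nonneg hγ hB), h, hsplit]

/-- **Markov-type averaging**: if `P` holds for a `≥ ρ` fraction of the pairs `(a, b)` (`ρ ≥ 0`),
then for a `≥ ρ/2` fraction of the `a`'s it holds for a `≥ ρ/2` fraction of the `b`'s. [folklore] -/
theorem card_rows_ge_of_density {A B : Type*} [Fintype A] [Fintype B] [Nonempty B]
    (P : A → B → Prop) [∀ a b, Decidable (P a b)] {ρ : ℝ} (hρ : 0 ≤ ρ)
    (h : ρ * (Fintype.card A * Fintype.card B) ≤
      ((univ.filter fun p : A × B => P p.1 p.2).card : ℝ)) :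
    ρ / 2 * Fintype.card A ≤ ((univ.filter fun a : A =>
      ρ / 2 * Fintype.card B ≤ ((univ.filter fun b => P a b).card : ℝ)).card : ℝ) := by
  classical
  set good := univ.filter fun a : A =>
    ρ / 2 * Fintype.card B ≤ ((univ.filter fun b => P a b).card : ℝ)
  have hrow : ∀ a : A, ((univ.filter fun b => P a b).card : ℝ) ≤ Fintype.card B := fun a => by
    exact_mod_cast (card_filter_le _ _).trans_eq (card_univ)
  have htot : ((univ.filter fun p : A × B => P p.1 p.2).card : ℝ) =
      ∑ a : A, ((univ.filter fun b => P a b).card : ℝ) := by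
    rw [natCast_card_filter, Fintype.sum_prod_type]
    exact Finset.sum_congr rfl fun a _ => by rw [natCast_card_filter]
  have hbad : ((univ.filter fun a : A => ¬ (ρ / 2 * Fintype.card B ≤
      ((univ.filter fun b => P a b).card : ℝ))).card : ℝ) ≤ Fintype.card A := by
    exact_mod_cast (card_filter_le _ _).trans_eq (card_univ)
  have hsplit : (∑ a : A, ((univ.filter fun b => P a b).card : ℝ)) ≤
      good.card * Fintype.card B + Fintype.card A * (ρ / 2 * Fintype.card B) := by
    rw [← Finset.sum_filter_add_sum_filter_not univ (fun a : A =>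
      ρ / 2 * Fintype.card B ≤ ((univ.filter fun b => P a b).card : ℝ))]
    refine add_le_add ?_ ?_
    · rw [← nsmul_eq_mul, ← Finset.sum_const]
      exact Finset.sum_le_sum fun a _ => hrow a
    · calc (∑ a ∈ univ.filter (fun a : A => ¬ (ρ / 2 * Fintype.card B ≤
            ((univ.filter fun b => P a b).card : ℝ))), ((univ.filter fun b => P a b).card : ℝ))
          ≤ ∑ _a ∈ univ.filter (fun a : A => ¬ (ρ / 2 * Fintype.card B ≤
            ((univ.filter fun b => P a b).card : ℝ))), (ρ / 2 * Fintype.card B) :=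
            Finset.sum_le_sum fun a ha => (not_le.1 (mem_filter.1 ha).2).le
        _ ≤ Fintype.card A * (ρ / 2 * Fintype.card B) := by
            rw [Finset.sum_const, nsmul_eq_mul]
            exact mul_le_mul_of_nonneg_right hbad (by positivity)
  rw [htot] at h
  have hBpos : (0 : ℝ) < Fintype.card B := Nat.cast_pos.2 Fintype.card_pos
  have hg0 : (0 : ℝ) ≤ good.card := Nat.cast_nonneg _
  nlinarith [h, hsplit]

/-- **Markov, counting form**: if `P` holds for at most an `η` fraction of the pairs `(a, b)`,
then the rows in which it holds for more than a `θ` fraction of the `b`'s (`θ > 0`) are at most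
an `η/θ` fraction. [folklore] -/
theorem card_heavyRows_le {A B : Type*} [Fintype A] [Fintype B] [Nonempty B]
    (P : A → B → Prop) [∀ a b, Decidable (P a b)] {η θ : ℝ} (hθ : 0 < θ)
    (h : ((univ.filter fun p : A × B => P p.1 p.2).card : ℝ) ≤
      η * (Fintype.card A * Fintype.card B)) :
    ((univ.filter fun a : A =>
        θ * Fintype.card B < ((univ.filter fun b => P a b).card : ℝ)).card : ℝ) ≤
      η / θ * Fintype.card A := by
  classical
  set heavy := univ.filter fun a : A =>
    θ * Fintype.card B < ((univ.filter fun b => P a b).card : ℝ)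
  have htot : ((univ.filter fun p : A × B => P p.1 p.2).card : ℝ) =
      ∑ a : A, ((univ.filter fun b => P a b).card : ℝ) := by
    rw [natCast_card_filter, Fintype.sum_prod_type]
    exact Finset.sum_congr rfl fun a _ => by rw [natCast_card_filter]
  have hlow : (heavy.card : ℝ) * (θ * Fintype.card B) ≤
      ∑ a : A, ((univ.filter fun b => P a b).card : ℝ) := by
    rw [← nsmul_eq_mul, ← Finset.sum_const]
    exact (Finset.sum_le_sum fun a ha => (mem_filter.1 ha).2.le).trans
      (Finset.sum_le_sum_of_subset_of_nonneg (subset_univ _) fun a _ _ => by positivity)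
  rw [← htot] at hlow
  have hBpos : (0 : ℝ) < Fintype.card B := Nat.cast_pos.2 Fintype.card_pos
  rw [div_mul_eq_mul_div, le_div_iff₀ hθ]
  nlinarith [hlow, h]

end Literature.Computability.Complexity
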